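import Summits.QuantumFields.BalabanUV.T4Continuum.Support.B13TermParamGaussianBiPi
import Summits.QuantumFields.BalabanUV.T4Continuum.Support.B13StepTermFamily
import Mathlib.Data.Complex.BigOperators

/-!
# B13TermCoreFamily — row O1-d2-ii «act instance» of the NE5 crux O1, part 7: THE TERM-LEVEL INSTANCE — the B13 tree-graph term family
# `B13StepTermFamily.term 𝒯 inc act` whose factor activities ARE (2.14)-cores (`act Z j := (𝔠 Z j).termAt`) satisfies the owner's ONE shape
# `OutputRateGaussianParamBi.TermGaussianParamBi` (R18), with the term's Gaussian data = the product core of its factors (part 6) weighted by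
# `𝟙[Rel]·ρᵀ·coeff`, and the operator letters of the TERM DERIVED from the operator letters of its FACTORS
# (cell `pub-balaban`, T⁴ fan-out, `HOME/t4/b2b-balaban-t4-ne5-p1/O1-CLAIM-TABLE-NE5-P1.md` row O1-d2-ii; design v0.5 R18)

Unit `b2b-balaban-t4-ne5-formalise-leaf-08` (NE5 formalisation swarm, leaf prover 08, gen 3).  Summits-side NEW WORK under the LEAN
PLACEMENT RULE (cell modelling + bookkeeping; nothing of the manuscripts under audit is asserted; 0 cite tags).  HONEST FRAMING: rung
(B)+1 of the FINITE-VOLUME T⁴ continuum programme — NOT infinite volume, NOT a mass gap, NOT the Clay problem, NOT a proof of NE5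
(`T4OutputRate.NE5` is NOT PRINTED and NOT PROVED; spine 0/9, unchanged).  HONEST DEPENDENCY (cell line, verbatim): continuum YM on T⁴ ⇐
BetaPertH ∧ nine spine estimates (0/9 proved); BetaPertH ⇐ (D1) ∧ (D4) ∧ CAP+tail; G-an2-4 gates asym, D1 and NE2/3/4.

WHAT THIS MODULE IS.  The END face `OutputRateGaussianParamBi.ne5_at_of_stepModel_termwise_gaussianParamBi_budget_scale_nat` consumes
`hBi : TermGaussianParamBi T W ctr RHist R′ …` for the TERM family `T` of the step model (with `TermRep`).  For the B13 step of record
`T = B13StepTermFamily.term 𝒯 inc act` — `𝟙[Rel k i X]·((len i + 1)!)⁻¹ρᵀ(i)·Π_{m ≤ len i} act (poly i m) (lab i m) o h`.  Parts 2–6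
typed ONE factor activity as `termAt` of a (2.14)-core and closed the cores under finite products.  Here:
* §0 transport helpers: `quasiMeasurePreserving_apply_piLp` (coordinate evaluation on `PiLp 2 V` is quasi-measure-preserving for the volumes,
  by part 6's `volume_preserving_ofLp_pi`), `differentiableOn_finset_prod` (finite products of holomorphic functions on a general normed domain).
* §1 `actOfCores 𝔠 Z j o h := (𝔠 Z j).termAt o h` and **`termCore 𝒯 inc 𝔠 k i X`** — the product core `BiCore.pi` of the factor cores
  `𝔠 (poly i m) (lab i m)`, `m : Fin (len i + 1)`, with weight `𝟙[Rel k i X]·coeff(i)·Π_m w_m` (weight LETTER `𝟙[Rel]·‖coeff‖·Π_m wB_m`) and, OFF the localization relation (where the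
  term is `0`), the decoupled toy letters `N := 1`, `q := ‖v‖²` (so that the shape's letter clauses are trivially met there and NO hypothesis
  on non-localizing tuples is needed); `termAt_termCore : (termCore … k i X).termAt o h = term 𝒯 inc (actOfCores 𝔠) k i o h X`.
* §2 **`termGaussianParamBi_term_of_factors`** — THE TERM-LEVEL INSTANCE: if for every tuple `i` localizing at a step-`k` domain and
  every factor `m` the factor core's operator letters hold on the operator ball (`N` a.e.-strongly measurable ∕ holomorphic ∕ `≤ N₀f`;
  `q` jointly a.e.-strongly measurable ∕ holomorphic ∕ affine margin `mf‖v‖² − bf ≤ Re q` with `0 < mf`), then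
  `TermGaussianParamBi (term 𝒯 inc (actOfCores 𝔠)) W ctr RHist R′ …` with the term data of §1 and the letters `m := min_m mf`,
  `b := Σ_m bf`, `N₀ := Π_m N₀f` (on localizing tuples; toy values off them), `w₀ := 𝟙[Rel]·‖coeff‖·Π_m wB_m`, `F := 1`, `N₁ := Σ_m N₁,m` —
  measurability along the coordinate maps (`Measure.quasiMeasurePreserving_eval`, §0), holomorphy of products∕sums, `‖v‖² = Σ_m ‖v_m‖²`
  (`PiLp.norm_sq_eq_of_L2`) for the margin.
  `termGaussianParamBi_term_of_factors_toy`: NON-VACUITY of the factor letters (toy `N := 1`, `q := ‖v‖²` on every factor).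
So the `hBi` binder of the END, for the B13 step whose activities are (2.14)-cores, REDUCES BY STRUCTURE to per-factor operator letters —
the Gaussian volumes `N` and quadratic forms `q` of `C^{(k)}(Z₀, σ)`, `Γ_k` (rows NE2∕NE3's objects; [II] (2.15)–(2.17) KIND, margins via
part 2's `margin_of_base`).  Those letters, the identification of Bałaban's (2.14) data with cores (contours: part 5; χ's: part 2), `TermRep`
(O1-d3) and every other binder of the END stay DISPLAYED.

STATUS (census, Edison rule).  Dictionary∕bookkeeping; no estimate of [II] is proved or asserted.  NE5 NOT PROVED; 0/12 leaves on
Bałaban's concrete objects; spine 0/9; rung (B)+1 finite T⁴; NOT infinite volume ∕ mass gap ∕ Clay.  0 sorry; axioms ⊆ {propext,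
Classical.choice, Quot.sound}.
-/

noncomputable section

open scoped BigOperators
open Set Metric MeasureTheory Finset WithLp

namespace Summit.QuantumFields.BalabanUV.T4Continuum.B13TermCoreFamily

open Literature.MathematicalPhysics.QuantumFieldTheory.Balaban1983to89
open Literature.MathematicalPhysics.QuantumFieldTheory.Balaban1983to89.T4OutputRate (Carriers)
open Summit.QuantumFields.BalabanUV.T4Continuum.B13HistMeasurable (MeasPotFrame B13HistM)
open Summit.QuantumFields.BalabanUV.T4Continuum.B13StepTermFamily (TermIndexing coeff term term_of_rel term_of_not_rel)
open Summit.QuantumFields.BalabanUV.T4Continuum.B13TermParamGaussianBi (BiCore)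
open Summit.QuantumFields.BalabanUV.T4Continuum.B13TermParamGaussianBiPi (volume_preserving_ofLp_pi)
open Summit.QuantumFields.BalabanUV.T4Continuum.OutputRateGaussianParamBi (TermGaussianParamBi)

/-! ## §0 Transport helpers -/

section Helpers

/-- [folklore] Coordinate evaluation on an `L²`-product of finite-dimensional inner-product spaces is quasi-measure-preserving for the
canonical volumes (part 6's `volume_preserving_ofLp_pi` + `Measure.quasiMeasurePreserving_eval`). -/
theorem quasiMeasurePreserving_apply_piLp {M : Type*} [Fintype M] (V : M → Type*) [∀ m, NormedAddCommGroup (V m)]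
    [∀ m, InnerProductSpace ℝ (V m)] [∀ m, FiniteDimensional ℝ (V m)] [∀ m, MeasurableSpace (V m)] [∀ m, BorelSpace (V m)] (m : M) :
    Measure.QuasiMeasurePreserving (fun v : PiLp 2 V => v m) volume volume :=
  (Measure.quasiMeasurePreserving_eval (fun _ => (volume : Measure (V _))) m).comp
    (volume_preserving_ofLp_pi V).quasiMeasurePreserving

/-- [folklore] A finite product of functions holomorphic on a set is holomorphic on it (general normed domain; Mathlib's
`DifferentiableOn.finsetProd` is stated for scalar domains). -/
theorem differentiableOn_finset_prod {𝕜 : Type*} [NontriviallyNormedField 𝕜] {E : Type*} [NormedAddCommGroup E] [NormedSpace 𝕜 E]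
    {𝔸 : Type*} [NormedCommRing 𝔸] [NormedAlgebra 𝕜 𝔸] {M : Type*} (s : Finset M) {f : M → E → 𝔸} {S : Set E}
    (h : ∀ m ∈ s, DifferentiableOn 𝕜 (f m) S) : DifferentiableOn 𝕜 (fun x => ∏ m ∈ s, f m x) S := by
  classical
  induction s using Finset.induction_on with
  | empty => simp only [Finset.prod_empty]; exact differentiableOn_const _
  | insert a s ha ih =>
    simp only [Finset.prod_insert ha]
    exact (h a (Finset.mem_insert_self a s)).mul (ih fun m hm => h m (Finset.mem_insert_of_mem hm))

end Helpers

variable {C : Carriers} {P : MeasPotFrame C} {Op : Type*} {ι Pol J : Type*}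
  (𝒯 : TermIndexing C ι Pol J) (inc : Pol → Pol → Prop) [DecidableRel inc]
  {𝒴 : Pol → J → Type*} {dom : ∀ Z j, 𝒴 Z j → C.Dom} {PΛ : Pol → J → Type*} {V : Pol → J → Type*}
  [∀ Z j, MeasurableSpace (PΛ Z j)] [∀ Z j, NormedAddCommGroup (V Z j)] [∀ Z j, InnerProductSpace ℝ (V Z j)]
  [∀ Z j, MeasurableSpace (V Z j)] (𝔠 : ∀ Z j, BiCore P (dom Z j) Op (PΛ Z j) (V Z j))

/-! ## §1 The core of a term; activities from cores -/

section Core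

/-- The factor cores of the term index `i`: `m ↦ 𝔠 (poly i m) (lab i m)`. [folklore] -/
abbrev factorCores (i : ι) : ∀ m : Fin (𝒯.len i + 1), BiCore P (dom (𝒯.poly i m) (𝒯.lab i m)) Op
    (PΛ (𝒯.poly i m) (𝒯.lab i m)) (V (𝒯.poly i m) (𝒯.lab i m)) :=
  fun m => 𝔠 (𝒯.poly i m) (𝒯.lab i m)

/-- **THE CORE OF THE TERM `(k, i, X)`**: the product core of the factors of `i` (part 6), with weight `𝟙[Rel k i X]·coeff(i)·Π_m w_m`
and — OFF the localization relation, where the term vanishes — the decoupled toy letters `N := 1`, `q := ‖v‖²`; every other field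
(parameter measure, constraints, polymer families, contour weights, field maps) is the product core's. [folklore] -/
def termCore (k : ℕ) (i : ι) (X : C.Dom) :
    BiCore P (fun Y : (Σ m : Fin (𝒯.len i + 1), 𝒴 (𝒯.poly i m) (𝒯.lab i m)) => dom _ _ Y.2) Op
      (∀ m : Fin (𝒯.len i + 1), PΛ (𝒯.poly i m) (𝒯.lab i m)) (PiLp 2 fun m : Fin (𝒯.len i + 1) => V (𝒯.poly i m) (𝒯.lab i m)) :=
  { BiCore.pi (factorCores 𝒯 𝔠 i) with
    w := fun p => if 𝒯.Rel k i X then coeff 𝒯 inc i * (BiCore.pi (factorCores 𝒯 𝔠 i)).w p else 0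
    measW := by
      by_cases h : 𝒯.Rel k i X
      · simp only [if_pos h]; exact measurable_const.mul (BiCore.pi (factorCores 𝒯 𝔠 i)).measW
      · simp only [if_neg h]; exact measurable_const
    wB := if 𝒯.Rel k i X then ‖coeff 𝒯 inc i‖ * (BiCore.pi (factorCores 𝒯 𝔠 i)).wB else 0
    norm_w_le := fun p => by
      by_cases h : 𝒯.Rel k i X
      · simp only [if_pos h, norm_mul]
        exact mul_le_mul_of_nonneg_left ((BiCore.pi (factorCores 𝒯 𝔠 i)).norm_w_le p) (norm_nonneg _)
      · simp only [if_neg h, norm_zero]; exact le_rfl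
    N := fun o p => if 𝒯.Rel k i X then (BiCore.pi (factorCores 𝒯 𝔠 i)).N o p else 1
    q := fun o p v => if 𝒯.Rel k i X then (BiCore.pi (factorCores 𝒯 𝔠 i)).q o p v else ((‖v‖ ^ 2 : ℝ) : ℂ) }

variable {𝒯 inc 𝔠}

/-- [folklore] The term core's parameter measure is the product of the factors' (by construction). -/
theorem lam_termCore (k : ℕ) (i : ι) (X : C.Dom) :
    (termCore 𝒯 inc 𝔠 k i X).lam = Measure.pi fun m => (factorCores 𝒯 𝔠 i m).lam := rfl

/-- [folklore] Its potential-free factor, read-out and read-out letter are the product core's (by construction). -/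
theorem chi_termCore (k : ℕ) (i : ι) (X : C.Dom) : (termCore 𝒯 inc 𝔠 k i X).chi = (BiCore.pi (factorCores 𝒯 𝔠 i)).chi := rfl

/-- [folklore] (read-out) -/
theorem readOut_termCore (k : ℕ) (i : ι) (X : C.Dom) :
    (termCore 𝒯 inc 𝔠 k i X).readOut = (BiCore.pi (factorCores 𝒯 𝔠 i)).readOut := rfl

/-- [folklore] (read-out letter: `N₁ = Σ_m N₁(factor m)`) -/
theorem N₁_termCore (k : ℕ) (i : ι) (X : C.Dom) :
    (termCore 𝒯 inc 𝔠 k i X).N₁ = ∑ m, (factorCores 𝒯 𝔠 i m).N₁ := BiCore.N₁_pi _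

/-- [folklore] (weight letter: `w₀ = 𝟙[Rel k i X]·‖coeff i‖·Π_m wB(factor m)` — ZERO off the localization relation, so that a per-domain mass
budget `a k i X := 0` for non-localizing `i` (R21) is met) -/
theorem wB_termCore (k : ℕ) (i : ι) (X : C.Dom) :
    (termCore 𝒯 inc 𝔠 k i X).wB = if 𝒯.Rel k i X then ‖coeff 𝒯 inc i‖ * ∏ m, (factorCores 𝒯 𝔠 i m).wB else 0 := rfl

variable [∀ Z j, BorelSpace (V Z j)] [∀ Z j, FiniteDimensional ℝ (V Z j)]

variable (𝔠) in
/-- THE FACTOR ACTIVITIES FROM CORES: `act Z j o h := (𝔠 Z j).termAt o h` — one resummed (2.14)-integral per factor `(Z, j)`. [folklore] -/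
def actOfCores : Pol → J → Op → B13HistM P → ℂ := fun Z j o h => (𝔠 Z j).termAt o h

/-- [folklore] **THE TERM CORE'S TERM IS THE B13 TERM**: `(termCore … k i X).termAt o h = term 𝒯 inc (actOfCores 𝔠) k i o h X` — ON the
localization relation `coeff·Π_m (𝔠 (poly i m) (lab i m)).termAt o h` by part 6's `termAt_pi`; OFF it both sides vanish. -/
theorem termAt_termCore (k : ℕ) (i : ι) (X : C.Dom) (o : Op) (h : B13HistM P) :
    (termCore 𝒯 inc 𝔠 k i X).termAt o h = term 𝒯 inc (actOfCores 𝔠) k i o h X := by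
  by_cases hR : 𝒯.Rel k i X
  · rw [term_of_rel 𝒯 inc _ hR, show (∏ m, actOfCores 𝔠 (𝒯.poly i m) (𝒯.lab i m) o h) =
        ∏ m, (factorCores 𝒯 𝔠 i m).termAt o h from rfl, ← BiCore.termAt_pi, BiCore.termAt, BiCore.termAt, ← integral_const_mul]
    refine integral_congr_ae (Filter.Eventually.of_forall fun p => ?_)
    show (if 𝒯.Rel k i X then coeff 𝒯 inc i * (BiCore.pi (factorCores 𝒯 𝔠 i)).w p else 0) *
        (if 𝒯.Rel k i X then (BiCore.pi (factorCores 𝒯 𝔠 i)).N o p else 1) *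
        (∫ v, (BiCore.pi (factorCores 𝒯 𝔠 i)).chi v * Complex.exp ((BiCore.pi (factorCores 𝒯 𝔠 i)).readOut p v h) *
          Complex.exp (-(if 𝒯.Rel k i X then (BiCore.pi (factorCores 𝒯 𝔠 i)).q o p v else ((‖v‖ ^ 2 : ℝ) : ℂ))) ∂volume) = _
    simp only [if_pos hR]
    ring
  · rw [term_of_not_rel 𝒯 inc _ hR, BiCore.termAt]
    refine integral_eq_zero_of_ae (Filter.Eventually.of_forall fun p => ?_)
    show (if 𝒯.Rel k i X then coeff 𝒯 inc i * (BiCore.pi (factorCores 𝒯 𝔠 i)).w p else 0) * _ * _ = 0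
    rw [if_neg hR, zero_mul, zero_mul]

/-- [folklore] Hence part 2's family term of the term cores IS the B13 term family: `(termCore … k i X).termAt o h` read as a function of
`(k, i, o, h, X)` equals `term 𝒯 inc (actOfCores 𝔠)`. -/
theorem termAt_termCore_eq : (fun k i o h X => (termCore 𝒯 inc 𝔠 k i X).termAt o h) = term 𝒯 inc (actOfCores 𝔠) :=
  funext fun k => funext fun i => funext fun o => funext fun h => funext fun X => termAt_termCore k i X o h

end Core

/-! ## §2 The shape of record for the B13 term family, from the FACTORS' operator letters -/

section Shape

variable {𝒯 inc 𝔠}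
variable [NormedAddCommGroup Op] [NormedSpace ℂ Op] [∀ Z j, BorelSpace (V Z j)] [∀ Z j, FiniteDimensional ℝ (V Z j)]

/-- **THE TERM-LEVEL INSTANCE** (R18, TERM level): if, for every tuple `i` localizing at a step-`k` domain `X` (`𝒯.Rel k i X`) and every
factor `m`, the factor core `𝔠 (poly i m) (lab i m)` has its operator letters on the open operator ball of the class centre — `N(o, ·)`
a.e.-strongly measurable, `N(·, p)` holomorphic, `‖N‖ ≤ N₀f`; `q(o, ·, ·)` jointly a.e.-strongly measurable, `q(·, p, v)` holomorphic, affine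
margin `mf‖v‖² − bf ≤ Re q` with `0 < mf` — then the B13 term family `term 𝒯 inc (actOfCores 𝔠)` satisfies `TermGaussianParamBi` with
the data of the term cores (§1) and the letters `m := min_m mf`, `b := Σ_m bf`, `N₀ := Π_m N₀f` on localizing tuples (toy values `1, 0, 1`
off them), `w₀ := 𝟙[Rel]·‖coeff i‖·Π_m wB_m`, `F := 1`, `N₁ := Σ_m N₁,m`.  Every clause BY STRUCTURE; the factor letters are the instancer's. [folklore] -/
theorem termGaussianParamBi_term_of_factors {W : Set (ℕ → ℝ)} {ctr : ℕ → (ℕ → ℝ) → C.BgB → Op × B13HistM P} {RHist R' : ℕ → ℝ}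
    {N₀f mf bf : Pol → J → ℝ} (hmf : ∀ Z j, 0 < mf Z j)
    (hNf : ∀ k, ∀ g ∈ W, ∀ (U : C.BgB) (X : C.Dom), C.scale X = k → ∀ i, 𝒯.Rel k i X → ∀ m : Fin (𝒯.len i + 1),
      (∀ o ∈ ball (ctr k g U).1 (R' k), AEStronglyMeasurable ((factorCores 𝒯 𝔠 i m).N o) (factorCores 𝒯 𝔠 i m).lam) ∧
      (∀ p, DifferentiableOn ℂ (fun o => (factorCores 𝒯 𝔠 i m).N o p) (ball (ctr k g U).1 (R' k))) ∧
      (∀ o ∈ ball (ctr k g U).1 (R' k), ∀ p, ‖(factorCores 𝒯 𝔠 i m).N o p‖ ≤ N₀f (𝒯.poly i m) (𝒯.lab i m)))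
    (hqf : ∀ k, ∀ g ∈ W, ∀ (U : C.BgB) (X : C.Dom), C.scale X = k → ∀ i, 𝒯.Rel k i X → ∀ m : Fin (𝒯.len i + 1),
      (∀ o ∈ ball (ctr k g U).1 (R' k),
        AEStronglyMeasurable (Function.uncurry ((factorCores 𝒯 𝔠 i m).q o)) ((factorCores 𝒯 𝔠 i m).lam.prod volume)) ∧
      (∀ p v, DifferentiableOn ℂ (fun o => (factorCores 𝒯 𝔠 i m).q o p v) (ball (ctr k g U).1 (R' k))) ∧
      (∀ o ∈ ball (ctr k g U).1 (R' k), ∀ p v,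
        mf (𝒯.poly i m) (𝒯.lab i m) * ‖v‖ ^ 2 - bf (𝒯.poly i m) (𝒯.lab i m) ≤ ((factorCores 𝒯 𝔠 i m).q o p v).re)) :
    TermGaussianParamBi (term 𝒯 inc (actOfCores 𝔠)) W ctr RHist R'
      (fun k i X => (termCore 𝒯 inc 𝔠 k i X).lam) (fun k i X => (termCore 𝒯 inc 𝔠 k i X).w)
      (fun k i X => (termCore 𝒯 inc 𝔠 k i X).N) (fun k i X _ v => (termCore 𝒯 inc 𝔠 k i X).chi v)
      (fun k i X => (termCore 𝒯 inc 𝔠 k i X).readOut) (fun k i X => (termCore 𝒯 inc 𝔠 k i X).q)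
      (fun k i X => if 𝒯.Rel k i X then Finset.univ.inf' Finset.univ_nonempty (fun m => mf (𝒯.poly i m) (𝒯.lab i m)) else 1)
      (fun k i X => if 𝒯.Rel k i X then ∑ m, bf (𝒯.poly i m) (𝒯.lab i m) else 0)
      (fun k i X => (termCore 𝒯 inc 𝔠 k i X).wB)
      (fun k i X => if 𝒯.Rel k i X then ∏ m, N₀f (𝒯.poly i m) (𝒯.lab i m) else 1) (fun _ _ _ => 1)
      fun k i X => (termCore 𝒯 inc 𝔠 k i X).N₁ := by
  intro k g hg U X hX i
  set 𝔱 := termCore 𝒯 inc 𝔠 k i X with h𝔱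
  set 𝔣 := factorCores 𝒯 𝔠 i with h𝔣
  haveI : ∀ m, IsFiniteMeasure (𝔣 m).lam := fun m => (𝔣 m).finite
  -- the structural clauses (independent of the localization relation)
  have hrepr : ∀ o ∈ ball (ctr k g U).1 (R' k), ∀ h ∈ closedBall (ctr k g U).2 (RHist k),
      term 𝒯 inc (actOfCores 𝔠) k i o h X = ∫ p, 𝔱.w p * 𝔱.N o p *
        ∫ v, 𝔱.chi v * Complex.exp (𝔱.readOut p v h) * Complex.exp (-𝔱.q o p v) ∂volume ∂𝔱.lam :=
    fun o _ h _ => (termAt_termCore k i X o h).symm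
  by_cases hR : 𝒯.Rel k i X
  · -- ON the localization relation: the product letters from the factor letters
    have hN : ∀ m, _ := fun m => hNf k g hg U X hX i hR m
    have hq : ∀ m, _ := fun m => hqf k g hg U X hX i hR m
    simp only [if_pos hR]
    refine ⟨𝔱.finite, (Finset.lt_inf'_iff _).2 fun m _ => hmf _ _, 𝔱.measW.aestronglyMeasurable, 𝔱.norm_w_le, ?_, ?_, ?_,
      (𝔱.measurable_chi.comp measurable_snd).aestronglyMeasurable, fun _ v => 𝔱.norm_chi_le_one v,
      fun y => (𝔱.measurable_readOut_apply y).aestronglyMeasurable, fun p v => 𝔱.norm_readOut_le p v, 𝔱.N₁_nonneg, ?_, ?_, ?_, hrepr⟩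
    · -- `N(o, ·)` a.e.-strongly measurable w.r.t. the product parameter measure
      intro o ho
      have hNo : 𝔱.N o = fun p => ∏ m, (𝔣 m).N o (p m) := by funext p; exact if_pos hR
      rw [hNo]
      exact Finset.aestronglyMeasurable_fun_prod _ fun m _ =>
        ((hN m).1 o ho).comp_quasiMeasurePreserving (Measure.quasiMeasurePreserving_eval (fun m => (𝔣 m).lam) m)
    · -- `N(·, p)` holomorphic
      intro p
      have hNp : (fun o => 𝔱.N o p) = fun o => ∏ m, (𝔣 m).N o (p m) := by funext o; exact if_pos hR
      rw [hNp]
      exact differentiableOn_finset_prod _ fun m _ => (hN m).2.1 (p m)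
    · -- `‖N‖ ≤ Π N₀f`
      intro o ho p
      have hNo : 𝔱.N o p = ∏ m, (𝔣 m).N o (p m) := if_pos hR
      rw [hNo, norm_prod]
      exact Finset.prod_le_prod (fun m _ => norm_nonneg _) fun m _ => (hN m).2.2 o ho (p m)
    · -- `q(o, ·, ·)` jointly a.e.-strongly measurable w.r.t. `(Measure.pi lam) ⊗ volume`
      intro o ho
      have hqo : Function.uncurry (𝔱.q o) = fun z => ∑ m, Function.uncurry ((𝔣 m).q o) (z.1 m, z.2 m) := by
        funext z; exact if_pos hR
      rw [hqo]
      refine Finset.aestronglyMeasurable_fun_sum _ fun m _ => ((hq m).1 o ho).comp_quasiMeasurePreserving ?_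
      exact MeasureTheory.QuasiMeasurePreserving.prodMap (Measure.quasiMeasurePreserving_eval (fun m => (𝔣 m).lam) m)
        (quasiMeasurePreserving_apply_piLp (fun m => V (𝒯.poly i m) (𝒯.lab i m)) m)
    · -- `q(·, p, v)` holomorphic
      intro p v
      have hqp : (fun o => 𝔱.q o p v) = fun o => ∑ m, (𝔣 m).q o (p m) (v m) := by funext o; exact if_pos hR
      rw [hqp]
      exact DifferentiableOn.fun_sum fun m _ => (hq m).2.1 (p m) (v m)
    · -- the affine margin: `(min_m mf)·‖v‖² − Σ bf ≤ Re Σ_m q_m`, `‖v‖² = Σ_m ‖v_m‖²`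
      intro o ho p v
      have hqo : 𝔱.q o p v = ∑ m, (𝔣 m).q o (p m) (v m) := if_pos hR
      rw [hqo, Complex.re_sum, PiLp.norm_sq_eq_of_L2, Finset.mul_sum, ← Finset.sum_sub_distrib]
      refine Finset.sum_le_sum fun m _ => ?_
      have hle : Finset.univ.inf' Finset.univ_nonempty (fun m => mf (𝒯.poly i m) (𝒯.lab i m)) ≤ mf (𝒯.poly i m) (𝒯.lab i m) :=
        Finset.inf'_le _ (Finset.mem_univ m)
      have h1 := (hq m).2.2 o ho (p m) (v m)
      nlinarith [sq_nonneg ‖v m‖]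
  · -- OFF the localization relation: the toy letters
    simp only [if_neg hR]
    refine ⟨𝔱.finite, one_pos, 𝔱.measW.aestronglyMeasurable, 𝔱.norm_w_le, ?_, ?_, ?_,
      (𝔱.measurable_chi.comp measurable_snd).aestronglyMeasurable, fun _ v => 𝔱.norm_chi_le_one v,
      fun y => (𝔱.measurable_readOut_apply y).aestronglyMeasurable, fun p v => 𝔱.norm_readOut_le p v, 𝔱.N₁_nonneg, ?_, ?_, ?_, hrepr⟩
    · intro o _
      have hNo : 𝔱.N o = fun _ => 1 := by funext p; exact if_neg hR
      rw [hNo]; exact aestronglyMeasurable_const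
    · intro p
      have hNp : (fun o => 𝔱.N o p) = fun _ => 1 := by funext o; exact if_neg hR
      rw [hNp]; exact differentiableOn_const 1
    · intro o _ p
      have hNo : 𝔱.N o p = 1 := if_neg hR
      rw [hNo]; simp
    · intro o _
      have hqo : Function.uncurry (𝔱.q o) = fun z => ((‖z.2‖ ^ 2 : ℝ) : ℂ) := by funext z; exact if_neg hR
      rw [hqo]
      exact (Complex.measurable_ofReal.comp ((measurable_snd.norm).pow_const 2)).aestronglyMeasurable
    · intro p v
      have hqp : (fun o => 𝔱.q o p v) = fun _ => ((‖v‖ ^ 2 : ℝ) : ℂ) := by funext o; exact if_neg hR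
      rw [hqp]; exact differentiableOn_const _
    · intro o _ p v
      have hqo : 𝔱.q o p v = ((‖v‖ ^ 2 : ℝ) : ℂ) := if_neg hR
      rw [hqo, Complex.ofReal_re]; simp

/-- **NON-VACUITY OF THE FACTOR LETTERS** (a test, not a model of [II]): if every factor core carries the decoupled toy letters `N := 1`,
`q(o, p, v) := ‖v‖²`, the binders `hNf`∕`hqf` of `termGaussianParamBi_term_of_factors` hold with `N₀f := 1`, `mf := 1`, `bf := 0` on EVERY
window ∕ centre ∕ radius, so the term-level shape is inhabited by the B13 term family of such cores. [folklore] -/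
theorem termGaussianParamBi_term_of_factors_toy {W : Set (ℕ → ℝ)} {ctr : ℕ → (ℕ → ℝ) → C.BgB → Op × B13HistM P}
    {RHist R' : ℕ → ℝ} (hN1 : ∀ Z j o p, (𝔠 Z j).N o p = 1) (hq1 : ∀ Z j o p v, (𝔠 Z j).q o p v = ((‖v‖ ^ 2 : ℝ) : ℂ)) :
    TermGaussianParamBi (term 𝒯 inc (actOfCores 𝔠)) W ctr RHist R'
      (fun k i X => (termCore 𝒯 inc 𝔠 k i X).lam) (fun k i X => (termCore 𝒯 inc 𝔠 k i X).w)
      (fun k i X => (termCore 𝒯 inc 𝔠 k i X).N) (fun k i X _ v => (termCore 𝒯 inc 𝔠 k i X).chi v)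
      (fun k i X => (termCore 𝒯 inc 𝔠 k i X).readOut) (fun k i X => (termCore 𝒯 inc 𝔠 k i X).q)
      (fun k i X => if 𝒯.Rel k i X then Finset.univ.inf' Finset.univ_nonempty (fun _ : Fin (𝒯.len i + 1) => (1 : ℝ)) else 1)
      (fun k i X => if 𝒯.Rel k i X then ∑ _m : Fin (𝒯.len i + 1), (0 : ℝ) else 0)
      (fun k i X => (termCore 𝒯 inc 𝔠 k i X).wB)
      (fun k i X => if 𝒯.Rel k i X then ∏ _m : Fin (𝒯.len i + 1), (1 : ℝ) else 1) (fun _ _ _ => 1)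
      fun k i X => (termCore 𝒯 inc 𝔠 k i X).N₁ := by
  refine termGaussianParamBi_term_of_factors (N₀f := fun _ _ => 1) (mf := fun _ _ => 1) (bf := fun _ _ => 0)
    (fun _ _ => one_pos) (fun k g _ U X _ i _ m => ⟨?_, ?_, ?_⟩) fun k g _ U X _ i _ m => ⟨?_, ?_, ?_⟩
  · intro o _
    have h : (factorCores 𝒯 𝔠 i m).N o = fun _ => 1 := funext fun p => hN1 _ _ o p
    rw [h]; exact aestronglyMeasurable_const
  · intro p
    have h : (fun o => (factorCores 𝒯 𝔠 i m).N o p) = fun _ => 1 := funext fun o => hN1 _ _ o p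
    rw [h]; exact differentiableOn_const 1
  · intro o _ p; rw [hN1]; simp
  · intro o _
    have h : Function.uncurry ((factorCores 𝒯 𝔠 i m).q o) = fun z => ((‖z.2‖ ^ 2 : ℝ) : ℂ) :=
      funext fun z => hq1 _ _ o z.1 z.2
    rw [h]
    exact (Complex.measurable_ofReal.comp ((measurable_snd.norm).pow_const 2)).aestronglyMeasurable
  · intro p v
    have h : (fun o => (factorCores 𝒯 𝔠 i m).q o p v) = fun _ => ((‖v‖ ^ 2 : ℝ) : ℂ) := funext fun o => hq1 _ _ o p v
    rw [h]; exact differentiableOn_const _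
  · intro o _ p v; rw [hq1, Complex.ofReal_re]; simp

end Shape

end Summit.QuantumFields.BalabanUV.T4Continuum.B13TermCoreFamily

end
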